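import Literature.Geometry.Lorentzian.KerrTimeDominatedEstimate
import Summits.FinalStateConjecture.FinalStateConjecture.Theorems.ClusterCompletenessAdiabaticMultiKerrILEDWeightedTCurrent

/-!
# Route ClusterCompleteness — crux `AdiabaticMultiKerrILED`, line `Sketch`:
# the weighted total Morawetz current `W · J_tot[Φ]` of the rest-frame tails-cut zone is `C¹`

Helper file for the crux `stmt-FinalStateConjecture-14310`
(`Summit.FinalStateConjecture.FinalStateConjecture.Theses.ClusterCompleteness.AdiabaticMultiKerrILED`),
line `Sketch`, stub `contDiff_weightedMorawetzCurrent` (lead c7, wave 5, Morawetz integration).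

Setting (one zone, zero spin, rest frame): the coefficient field is the tails-cut Kerr–Schild field
`G₀ = KerrSchild.inverseMetric φ (Kerr.nullVector 0)` with the stationary profile
`φ(y) = χ(2 − r(y)/(8M)) · 2H(y)` (`χ = Real.smoothTransition`, `r = Kerr.radius 0 = ‖y⃗‖`), and
`f = 1 − φ`. The TOTAL MORAWETZ CURRENT of the degenerate Morawetz estimate is
`J_tot = J^X + ¼ L^{ϖ₂} + J_H + J^T` with

* the radial multiplier `X = F(r) ∂_{r*}`, `F = 1 − 3M/r`, i.e. `X⁰ = F φ`, `Xⁱ = F f xⁱ/r`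
  (`KerrSchild.multiplierCurrent G₀ X Φ`);
* the Lagrangian correction with weight `ϖ₂(r) = 2(1 − 2M/r)((2r − 3M)/r² − M³(r − 3M)²/r⁶)`
  (`KerrSchild.lagrangianCurrent G₀ (ϖ₂ ∘ r) Φ`);
* the Hardy current `J_H^μ = ½ ŷ(r) Φ² (∂_{r*})^μ`, `(∂_{r*})⁰ = φ`, `(∂_{r*})ⁱ = f xⁱ/r`, with the
  glued weight `ŷ(s) = 𝟙_{s ≤ 7M} 2(7M − s)² q_θ(s/M)/(M³ s)` (`q_θ` an explicit quintic);
* the Killing current `J^T` (`KerrSchild.timeField`).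

The weight is `W = χ(u₂/ε − 1) · χ(2 − ‖y⃗‖²/R²)` with the receding horizon function
`u₂ = Kerr.horizonFn M 0 = (r − 2M) e^{−x⁰/(2M)}` and the static spatial cut-off.

Main result `contDiff_weightedMorawetzCurrent`: **`W · J_tot^μ ∈ C¹(ℝ⁴)` for `Φ ∈ C²(ℝ⁴)`**
(hypothesis `hJ1` of the weighted graph-flux lemma). Proof: off `{r ≤ M}` every factor is `C¹`
at the point — `G₀`, `X`, `ϖ₂ ∘ r`, `∂_{r*}` are smooth on `{r > 0}`
(`contDiffAt_tailsCut_inverseMetric`, `Kerr.contDiffAt_radius`, `Kerr.contDiffAt_scalarH`), the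
Hardy weight `ŷ` is `C¹` on `(0, ∞)` since `ŷ(s) = (max (7M − s) 0)² · 2 q_θ(s/M)/(M³ s)` has a
double zero at `s = 7M` (`Kerr.hasDerivAt_max_sub_zero_sq`), and the currents are polynomial in
these data and in `Φ`, `dΦ` (`KerrSchild.contDiffAt_multiplierCurrent`,
`KerrSchild.contDiffAt_lagrangianCurrent`) — this is `contDiffAt_morawetzTotalCurrent`; on
`{r < 2M}` one has `u₂ ≤ 0 < ε`, so the horizon factor `χ(u₂/ε − 1)`, hence the product, vanishes
identically, and `Kerr.contDiff_of_eq_zero_of_radius_lt` glues the two regions. Model: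
`contDiff_weightedTCurrent` (the same programme for `J^T` alone).

Dafermos–Rodnianski–Shlapentokh-Rothman arXiv:1402.7034, §2.3.1 (the currents `J^X`, `J^{X,ϖ}`
and their regularity for `C²` solutions). [folklore]
-/

noncomputable section

-- the doubled `FinalStateConjecture.FinalStateConjecture` path component trips dupNamespace
set_option linter.dupNamespace false

open Set Filter
open scoped BigOperators Topology
open Literature.Geometry.Lorentzian

namespace Summit.FinalStateConjecture.FinalStateConjecture.Theorems

/-! ### One-variable regularity: the glued Hardy weight and the Lagrangian weight -/

/-- `t ↦ (max (c − t) 0)²` is `C¹` on `ℝ`: it is differentiable with the continuous derivative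
`−2 max (c − t) 0` (`Kerr.hasDerivAt_max_sub_zero_sq`). [folklore] -/
theorem morawetzReg_contDiff_max_sub_sq (c : ℝ) : ContDiff ℝ 1 (fun t : ℝ ↦ max (c - t) 0 ^ 2) := by
  rw [contDiff_one_iff_deriv]
  refine ⟨fun t ↦ (Kerr.hasDerivAt_max_sub_zero_sq c t).differentiableAt, ?_⟩
  have h : deriv (fun t : ℝ ↦ max (c - t) 0 ^ 2) = fun t ↦ -(2 * max (c - t) 0) :=
    funext fun t ↦ (Kerr.hasDerivAt_max_sub_zero_sq c t).deriv
  rw [h]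
  exact (continuous_const.mul ((continuous_const.sub continuous_id).max continuous_const)).neg

/-- **The glued Hardy weight `ŷ` is `C¹` off the origin.** For `M ≠ 0`, `s ≠ 0` and any `C¹`
function `q`, the function `ŷ(t) = 𝟙_{t ≤ 7M} · 2 (7M − t)² q(t/M)/(M³ t)` is `C¹` at `s`: it
coincides on all of `ℝ` with `(max (7M − t) 0)² · (2 q(t/M)/(M³ t))` (a double zero at `t = 7M`),
a product of a `C¹` function and a function smooth off `t = 0`. [folklore] -/
theorem morawetzReg_contDiffAt_hardyWeight {M s : ℝ} (hM : M ≠ 0) (hs : s ≠ 0) {q : ℝ → ℝ}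
    (hq : ContDiff ℝ 1 q) :
    ContDiffAt ℝ 1
      (fun t ↦ if t ≤ 7 * M then 2 * (7 * M - t) ^ 2 * q (t / M) / (M ^ 3 * t) else 0) s := by
  have heq : (fun t ↦ if t ≤ 7 * M then 2 * (7 * M - t) ^ 2 * q (t / M) / (M ^ 3 * t) else 0) =
      fun t ↦ max (7 * M - t) 0 ^ 2 * (2 * q (t / M) / (M ^ 3 * t)) := by
    funext t
    split_ifs with h
    · rw [max_eq_left (sub_nonneg.mpr h)]
      ring
    · rw [max_eq_right (sub_nonpos.mpr (not_le.mp h).le), zero_pow two_ne_zero, zero_mul]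
  rw [heq]
  have h2 : ContDiffAt ℝ 1 (fun t ↦ 2 * q (t / M) / (M ^ 3 * t)) s :=
    (contDiffAt_const.mul (hq.contDiffAt.comp s (contDiffAt_id.div_const M))).div
      (contDiffAt_const.mul contDiffAt_id) (mul_ne_zero (pow_ne_zero 3 hM) hs)
  exact (morawetzReg_contDiff_max_sub_sq (7 * M)).contDiffAt.mul h2

/-- The Lagrangian weight `ϖ₂(s) = 2(1 − 2M/s)((2s − 3M)/s² − M³(s − 3M)²/s⁶)` is smooth off the
origin (a rational function whose denominators are powers of `s`). [folklore] -/
theorem morawetzReg_contDiffAt_lagrangianWeight (M : ℝ) {s : ℝ} (hs : s ≠ 0) {n : WithTop ℕ∞} :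
    ContDiffAt ℝ n (fun s ↦ 2 * ((1 - 2 * M / s) *
      ((2 * s - 3 * M) / s ^ 2 - M ^ 3 * (s - 3 * M) ^ 2 / s ^ 6))) s := by
  have hid : ContDiffAt ℝ n (fun t : ℝ ↦ t) s := contDiffAt_id
  exact contDiffAt_const.mul ((contDiffAt_const.sub (contDiffAt_const.div hid hs)).mul
    ((((contDiffAt_const.mul hid).sub contDiffAt_const).div (hid.pow 2) (pow_ne_zero 2 hs)).sub
      ((contDiffAt_const.mul ((hid.sub contDiffAt_const).pow 2)).div (hid.pow 6)
        (pow_ne_zero 6 hs))))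

/-! ### The stationary coefficient functions are smooth on `{r > 0}` -/

/-- The tails-cut profile `φ = χ(2 − r/(8M)) · 2H` is smooth wherever `r > 0` (`r` and `H` are
smooth off the disc, `χ` is smooth). [folklore] -/
theorem morawetzReg_contDiffAt_profile (M : ℝ) {x : E4} (hx : 0 < Kerr.radius 0 x) {n : ℕ∞} :
    ContDiffAt ℝ n (fun y ↦ Real.smoothTransition (2 - Kerr.radius 0 y / (8 * M)) *
      (2 * Kerr.scalarH M 0 y)) x := by
  have hr : ContDiffAt ℝ (n : WithTop ℕ∞) (fun y ↦ 2 - Kerr.radius 0 y / (8 * M)) x :=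
    contDiffAt_const.sub ((Kerr.contDiffAt_radius hx).div_const _)
  have hχ : ContDiffAt ℝ (n : WithTop ℕ∞)
      (fun y ↦ Real.smoothTransition (2 - Kerr.radius 0 y / (8 * M))) x :=
    Real.smoothTransition.contDiff.contDiffAt.comp x hr
  exact hχ.mul (contDiffAt_const.mul (Kerr.contDiffAt_scalarH M 0 hx))

/-- The components of the radial multiplier `X = F(r) ∂_{r*}` — `X⁰ = F φ`, `Xⁱ = F f xⁱ/r` with
`F = 1 − 3M/r`, `φ` the tails-cut profile, `f = 1 − φ` — are smooth wherever `r > 0`. [folklore] -/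
theorem morawetzReg_contDiffAt_radialField (M : ℝ) {x : E4} (hx : 0 < Kerr.radius 0 x)
    (α : Fin 4) {n : ℕ∞} :
    ContDiffAt ℝ n (fun y ↦ if α = 0 then (1 - 3 * M / Kerr.radius 0 y) *
        (Real.smoothTransition (2 - Kerr.radius 0 y / (8 * M)) * (2 * Kerr.scalarH M 0 y))
      else (1 - 3 * M / Kerr.radius 0 y) *
        (1 - Real.smoothTransition (2 - Kerr.radius 0 y / (8 * M)) * (2 * Kerr.scalarH M 0 y)) *
          y α / Kerr.radius 0 y) x := by
  have hr : ContDiffAt ℝ (n : WithTop ℕ∞) (Kerr.radius 0) x := Kerr.contDiffAt_radius hx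
  have hF : ContDiffAt ℝ (n : WithTop ℕ∞) (fun y ↦ 1 - 3 * M / Kerr.radius 0 y) x :=
    contDiffAt_const.sub (contDiffAt_const.div hr hx.ne')
  have hp := morawetzReg_contDiffAt_profile M hx (n := n)
  by_cases hα : α = 0
  · simp only [if_pos hα]
    exact hF.mul hp
  · simp only [if_neg hα]
    exact ((hF.mul (contDiffAt_const.sub hp)).mul (Kerr.contDiff_coord α).contDiffAt).div hr hx.ne'

/-- The components of the tortoise field `∂_{r*}` — `(∂_{r*})⁰ = φ`, `(∂_{r*})ⁱ = f xⁱ/r` — are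
smooth wherever `r > 0`. [folklore] -/
theorem morawetzReg_contDiffAt_tortoiseField (M : ℝ) {x : E4} (hx : 0 < Kerr.radius 0 x)
    (μ : Fin 4) {n : ℕ∞} :
    ContDiffAt ℝ n (fun y ↦ if μ = 0 then
        Real.smoothTransition (2 - Kerr.radius 0 y / (8 * M)) * (2 * Kerr.scalarH M 0 y)
      else (1 - Real.smoothTransition (2 - Kerr.radius 0 y / (8 * M)) * (2 * Kerr.scalarH M 0 y)) *
        y μ / Kerr.radius 0 y) x := by
  have hr : ContDiffAt ℝ (n : WithTop ℕ∞) (Kerr.radius 0) x := Kerr.contDiffAt_radius hx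
  have hp := morawetzReg_contDiffAt_profile M hx (n := n)
  by_cases hμ : μ = 0
  · simp only [if_pos hμ]
    exact hp
  · simp only [if_neg hμ]
    exact ((contDiffAt_const.sub hp).mul (Kerr.contDiff_coord μ).contDiffAt).div hr hx.ne'

/-! ### The total Morawetz current is `C¹` at the points of `{r > 0}` -/

/-- **The total Morawetz current of a `C²` function is `C¹` at every point of `{r > 0}`** (zero
spin, `M > 0`): the map `y ↦ J_tot^μ(y) = (J^X + ¼ L^{ϖ₂} + J_H + J^T)^μ(y)`. The coefficients
`G₀^{μν}` are smooth at the point (`contDiffAt_tailsCut_inverseMetric`), the multipliers `X`, `T`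
and the tortoise components are smooth there, `ϖ₂ ∘ r` is smooth and `ŷ ∘ r` is `C¹` there
(`r > 0`), `Φ` is `C²`; the currents are polynomial in these data
(`KerrSchild.contDiffAt_multiplierCurrent`, `KerrSchild.contDiffAt_lagrangianCurrent`).
DRSR arXiv:1402.7034, §2.3.1. [folklore] -/
theorem contDiffAt_morawetzTotalCurrent : ∀ (M : ℝ) (Φ : E4 → ℝ) (x : E4), 0 < M → 0 < Kerr.radius 0 x → ContDiffAt ℝ 2 Φ x → ∀ μ : Fin 4, ContDiffAt ℝ 1 (fun y ↦ KerrSchild.multiplierCurrent (KerrSchild.inverseMetric (fun y ↦ Real.smoothTransition (2 - Kerr.radius 0 y / (8 * M)) * (2 * Kerr.scalarH M 0 y)) (Kerr.nullVector 0)) (fun (z : E4) (α : Fin 4) ↦ if α = 0 then (1 - 3 * M / Kerr.radius 0 z) * (Real.smoothTransition (2 - Kerr.radius 0 z / (8 * M)) * (2 * Kerr.scalarH M 0 z)) else (1 - 3 * M / Kerr.radius 0 z) * (1 - (Real.smoothTransition (2 - Kerr.radius 0 z / (8 * M)) * (2 * Kerr.scalarH M 0 z))) * z α / Kerr.radius 0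 z) Φ y μ + 4⁻¹ * KerrSchild.lagrangianCurrent (KerrSchild.inverseMetric (fun y ↦ Real.smoothTransition (2 - Kerr.radius 0 y / (8 * M)) * (2 * Kerr.scalarH M 0 y)) (Kerr.nullVector 0)) (fun z ↦ (fun s ↦ 2 * ((1 - 2 * M / s) * ((2 * s - 3 * M) / s ^ 2 - M ^ 3 * (s - 3 * M) ^ 2 / s ^ 6))) (Kerr.radius 0 z)) Φ y μ + 2⁻¹ * (fun s ↦ if s ≤ 7 * M then 2 * (7 * M - s) ^ 2 * (fun ρ ↦ (-((593459 : ℝ) / 10000000)) + (788874 : ℝ) / 10000000 * ρ - (383061 : ℝ) / 10000000 * ρ ^ 2 + (92031 : ℝ) / 10000000 * ρ ^ 3 - (10985 : ℝ) / 10000000 * ρ ^ 4 + (525 : ℝ) / 10000000 * ρ ^ 5) (s / M) / (M ^ 3 * s) else 0) (Kerr.radius 0 y) * Φ y ^ 2 * (if μ = 0 then (Real.smoothTransition (2 - Kerr.radius 0 y / (8 * M)) * (2 * Kerr.scalarH M 0 y)) else (1 - (Real.smoothTransition (2 - Kerr.radius 0 y / (8 * M)) * (2 * Kerr.scalarH M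 0 y))) * y μ / Kerr.radius 0 y) + KerrSchild.multiplierCurrent (KerrSchild.inverseMetric (fun y ↦ Real.smoothTransition (2 - Kerr.radius 0 y / (8 * M)) * (2 * Kerr.scalarH M 0 y)) (Kerr.nullVector 0)) KerrSchild.timeField Φ y μ) x := by
  intro M Φ x hM hx hΦ μ
  have hG : ∀ μ ν, ContDiffAt ℝ 1 (fun y ↦ KerrSchild.inverseMetric
      (fun z ↦ Real.smoothTransition (2 - Kerr.radius 0 z / (8 * M)) * (2 * Kerr.scalarH M 0 z))
      (Kerr.nullVector 0) y μ ν) x :=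
    fun μ ν ↦ contDiffAt_tailsCut_inverseMetric M 0 hx μ ν (n := 1)
  have hX := fun α ↦ morawetzReg_contDiffAt_radialField M hx α (n := 1)
  have hT : ∀ α, ContDiffAt ℝ 1 (fun y ↦ KerrSchild.timeField y α) x :=
    fun α ↦ (KerrSchild.contDiff_timeField α).contDiffAt
  have hr1 : ContDiffAt ℝ 1 (Kerr.radius 0) x := Kerr.contDiffAt_radius hx
  have hr2 : ContDiffAt ℝ 2 (Kerr.radius 0) x := Kerr.contDiffAt_radius hx
  have hϖ : ContDiffAt ℝ 2 (fun z ↦ (fun s ↦ 2 * ((1 - 2 * M / s) *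
      ((2 * s - 3 * M) / s ^ 2 - M ^ 3 * (s - 3 * M) ^ 2 / s ^ 6))) (Kerr.radius 0 z)) x :=
    (morawetzReg_contDiffAt_lagrangianWeight M hx.ne').comp x hr2
  have hq : ContDiff ℝ 1 (fun ρ : ℝ ↦ (-((593459 : ℝ) / 10000000)) + (788874 : ℝ) / 10000000 * ρ -
      (383061 : ℝ) / 10000000 * ρ ^ 2 + (92031 : ℝ) / 10000000 * ρ ^ 3 -
      (10985 : ℝ) / 10000000 * ρ ^ 4 + (525 : ℝ) / 10000000 * ρ ^ 5) := by
    fun_prop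
  have hy : ContDiffAt ℝ 1 (fun y ↦ (fun s ↦ if s ≤ 7 * M then 2 * (7 * M - s) ^ 2 *
      (fun ρ ↦ (-((593459 : ℝ) / 10000000)) + (788874 : ℝ) / 10000000 * ρ -
        (383061 : ℝ) / 10000000 * ρ ^ 2 + (92031 : ℝ) / 10000000 * ρ ^ 3 -
        (10985 : ℝ) / 10000000 * ρ ^ 4 + (525 : ℝ) / 10000000 * ρ ^ 5) (s / M) / (M ^ 3 * s)
      else 0) (Kerr.radius 0 y)) x :=
    (morawetzReg_contDiffAt_hardyWeight hM.ne' hx.ne' hq).comp x hr1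
  have hd := morawetzReg_contDiffAt_tortoiseField M hx μ (n := 1)
  have hΦ1 : ContDiffAt ℝ 1 Φ x := hΦ.of_le one_le_two
  exact (((KerrSchild.contDiffAt_multiplierCurrent hG hX hΦ μ).add
    ((contDiffAt_const (c := (4⁻¹ : ℝ))).mul
      (KerrSchild.contDiffAt_lagrangianCurrent hG hϖ hΦ μ))).add
    ((((contDiffAt_const (c := (2⁻¹ : ℝ))).mul hy).mul (hΦ1.pow 2)).mul hd)).add
    (KerrSchild.contDiffAt_multiplierCurrent hG hT hΦ μ)

/-! ### The registered stub -/

/-- **The weighted total Morawetz current of a `C²` function is `C¹` on all of `ℝ⁴`** (tails-cut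
zero-spin zone, `M > 0`, `ε > 0`, `R > 0`): the map `y ↦ W(y) J_tot^μ(y)` with
`W = χ(u₂/ε − 1) χ(2 − ‖y⃗‖²/R²)` and `J_tot = J^X + ¼ L^{ϖ₂} + J_H + J^T`. At points with `r > M`
every factor is `C¹`: the horizon factor is smooth on `ℝ⁴` (`Kerr.contDiff_horizonFactor`,
`r₊ = 2M > 0`), the static cut-off is smooth (`‖y⃗‖²` is a polynomial), and the current is `C¹`
there (`contDiffAt_morawetzTotalCurrent`); on `{r < 2M}` one has `u₂ ≤ 0`, so `χ(u₂/ε − 1) = 0`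
and the product vanishes identically (`Kerr.contDiff_of_eq_zero_of_radius_lt`).
DRSR arXiv:1402.7034, §2.3.1. [folklore] -/
theorem contDiff_weightedMorawetzCurrent : ∀ (M ε R : ℝ) (Φ : E4 → ℝ), 0 < M → 0 < ε → 0 < R → ContDiff ℝ 2 Φ → ∀ μ : Fin 4, ContDiff ℝ 1 (fun y ↦ (Real.smoothTransition (Kerr.horizonFn M 0 y / ε - 1) * Real.smoothTransition (2 - E4.spatialNorm y ^ 2 / R ^ 2)) * (KerrSchild.multiplierCurrent (KerrSchild.inverseMetric (fun y ↦ Real.smoothTransition (2 - Kerr.radius 0 y / (8 * M)) * (2 * Kerr.scalarH M 0 y)) (Kerr.nullVector 0)) (fun (z : E4) (α : Fin 4) ↦ if α = 0 then (1 - 3 * M / Kerr.radius 0 z) * (Real.smoothTransition (2 - Kerr.radius 0 z / (8 * M)) * (2 * Kerr.scalarH M 0 z)) else (1 - 3 * M / Kerr.radius 0 z) * (1 - (Real.smoothTransition (2 - Kerr.radius 0 z / (8 * M)) * (2 * Kerr.scalarH M 0 z))) * z α / Kerr.radius 0 z) Φ y μ + 4⁻¹ * KerrSchild.lagrangianCurrent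 (KerrSchild.inverseMetric (fun y ↦ Real.smoothTransition (2 - Kerr.radius 0 y / (8 * M)) * (2 * Kerr.scalarH M 0 y)) (Kerr.nullVector 0)) (fun z ↦ (fun s ↦ 2 * ((1 - 2 * M / s) * ((2 * s - 3 * M) / s ^ 2 - M ^ 3 * (s - 3 * M) ^ 2 / s ^ 6))) (Kerr.radius 0 z)) Φ y μ + 2⁻¹ * (fun s ↦ if s ≤ 7 * M then 2 * (7 * M - s) ^ 2 * (fun ρ ↦ (-((593459 : ℝ) / 10000000)) + (788874 : ℝ) / 10000000 * ρ - (383061 : ℝ) / 10000000 * ρ ^ 2 + (92031 : ℝ) / 10000000 * ρ ^ 3 - (10985 : ℝ) / 10000000 * ρ ^ 4 + (525 : ℝ) / 10000000 * ρ ^ 5) (s / M) / (M ^ 3 * s) else 0) (Kerr.radius 0 y) * Φ y ^ 2 * (if μ = 0 then (Real.smoothTransition (2 - Kerr.radius 0 y / (8 * M)) * (2 * Kerr.scalarH M 0 y)) else (1 - (Real.smoothTransition (2 - Kerr.radius 0 y / (8 * M)) * (2 * Kerr.scalarH M 0 y))) * y μ / Kerr.radius 0 y) + KerrSchild.multiplierCurrent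 (KerrSchild.inverseMetric (fun y ↦ Real.smoothTransition (2 - Kerr.radius 0 y / (8 * M)) * (2 * Kerr.scalarH M 0 y)) (Kerr.nullVector 0)) KerrSchild.timeField Φ y μ)) := by
  intro M ε R Φ hM hε _hR hΦ μ
  have hrp : 0 < Kerr.rPlus M 0 := by
    rw [Kerr.rPlus_zero_right hM.le]
    positivity
  refine Kerr.contDiff_of_eq_zero_of_radius_lt (a := 0) (c := 2 * M) (by positivity)
    (fun x hx ↦ ?_) (fun x hx ↦ ?_)
  · -- inside `{r < 2M}` the horizon factor vanishes
    have h1 : Kerr.horizonFn M 0 x ≤ 0 := by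
      unfold Kerr.horizonFn
      rw [Kerr.rPlus_zero_right hM.le]
      exact mul_nonpos_iff.mpr (Or.inr ⟨by linarith, (Real.exp_pos _).le⟩)
    have h2 : Kerr.horizonFn M 0 x / ε - 1 ≤ 0 := by
      have : Kerr.horizonFn M 0 x / ε ≤ 0 := div_nonpos_iff.mpr (Or.inr ⟨h1, hε.le⟩)
      linarith
    rw [Real.smoothTransition.zero_of_nonpos h2, zero_mul, zero_mul]
  · -- on `{r > M}` every factor is `C¹` at `x`
    have hxpos : 0 < Kerr.radius 0 x := lt_trans (by positivity) hx
    have hW₁ : ContDiffAt ℝ 1 (fun y ↦ Real.smoothTransition (Kerr.horizonFn M 0 y / ε - 1)) x :=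
      (Kerr.contDiff_horizonFactor (a := 0) (n := 1) hrp hε).contDiffAt
    have hW₂ : ContDiffAt ℝ 1
        (fun y : E4 ↦ Real.smoothTransition (2 - E4.spatialNorm y ^ 2 / R ^ 2)) x :=
      ((Real.smoothTransition.contDiff (n := 1)).comp
        (contDiff_const.sub (Kerr.contDiff_spatialNorm_sq.div_const _))).contDiffAt
    exact (hW₁.mul hW₂).mul (contDiffAt_morawetzTotalCurrent M Φ x hM hxpos hΦ.contDiffAt μ)

end Summit.FinalStateConjecture.FinalStateConjecture.Theorems
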